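import Summits.AnomalousDissipation.AnomalousDissipation.Theorems.MirrorVarietyTaylorGreenLoudGalerkinStatesStubGaugeBackward
import Summits.AnomalousDissipation.AnomalousDissipation.Theorems.MirrorVarietyTaylorGreenLoudGalerkinStatesStubScaling
import Summits.AnomalousDissipation.AnomalousDissipation.Theorems.MirrorVarietyTaylorGreenLoudGalerkinStatesStubGaugeNorms
import Summits.AnomalousDissipation.AnomalousDissipation.Theorems.MirrorVarietyTaylorGreenLoudGalerkinStatesGauge

/-!
# Sub-goal `gaugeHeart_of_exactStates` of the line `stagnation-plug-froth` (skeleton v4, gauge reshape)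
# (crux stmt-AnomalousDissipation-2987, `MirrorVariety.TaylorGreenLoudGalerkinStates`)

**The honesty direction of the amplitude gauge.**  Exact, `K`-nondegenerate, loud, bounded `K`-symmetric
steady Taylor–Green states along `ν_j → 0⁺` (energy `≤ E₁`, loudness `ε₁ ≤ ν_j‖∇U_j‖²`, `K`-tested steady
equations, `K`-inf-sup constants `M_j`) imply the registered heart `stub_gaugeHeart` of the v4 skeleton
(bounded, non-degenerate, `K`-nondegenerate frozen-cell solutions `2•f_TG + v_j`, `v_j ⊥ f_TG`, along gauge
viscosities tending to `0`).  Together with the landed glue `Gauge.stub_froth_of_gauge` (the opposite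
direction) this certifies that the gauge reformulation of the line's heart is lossless.

The proof is bookkeeping over landed material.  With the injection `W_j := ∫⟪f_TG, U_j⟫`:
* `W_j = ν_j‖∇U_j‖² ≥ ε₁ > 0` (`GaugeBackward.energy_identity`) and `W_j ≤ ∫‖U_j‖ ≤ √(∫‖U_j‖²) ≤ √E₁`
  (`‖f_TG‖ ≤ 1` pointwise, `Negative.norm_tgForce_le`, and Jensen `Negative.integral_norm_le_sqrt`);
* the gauge field `v_j := (1/(2W_j))•U_j − 2•f_TG` is a `K`-field orthogonal to `f_TG` solving the
  frozen-cell equations at the gauge viscosity `μ_j := ν_j/(2W_j)` (`GaugeBackward.stub_gaugeBackward`,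
  verbatim), and `0 < μ_j ≤ ν_j/(2ε₁) → 0`;
* `2•f_TG + v_j = (1/(2W_j))•U_j`, so by `GaugeNorms.stub_gaugeNorms` and the covariance
  `Scaling.integral_norm_sq_const_smul` / `Scaling.gradNormSq_const_smul`:
  `1 + ∫‖v_j‖² = ∫‖U_j‖²/(4W_j²) ≤ E₁/(4ε₁²)` and `12π² + ‖∇v_j‖² = ‖∇U_j‖²/(4W_j²)`, whence
  `μ_j‖∇v_j‖² = 1/(8W_j²) − 6π²ν_j/W_j ≥ 1/(8E₁) − 6π²ν_j/ε₁ ≥ 1/(16E₁)` as soon as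
  `ν_j ≤ ε₁/(96π²E₁)`, i.e. for `j ≥ J₀` (`ν_j → 0`); the witnesses are REINDEXED by `J₀`;
* inf-sup: `linForm μ_j ((1/(2W_j))•U_j) w a = (1/(2W_j))·linForm ν_j U_j w a` (`Scaling.linForm_scaling`),
  so the constants `M_j·2W_j` work.

Constants: `C = E₁/(4ε₁²)`, `c = 1/(16E₁)`.  Sources: the landed stub files imported above and
`Theorems/TaylorGreenLoudGalerkinStates/Negative/{LoadBearing,Anatomy}.lean`; the mathematics is folklore
(Temam, *Navier–Stokes Equations* (1979), Ch. II §1: energy identity and scaling of steady states; idea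
card `Cruxes/TaylorGreenLoudGalerkinStates/Ideas/frozen-cell-amplitude-gauge.md`).
-/

-- the mandated summit-side namespace duplicates the summit name (CONVENTIONS §2); deliberate
set_option linter.dupNamespace false
noncomputable section
open scoped BigOperators Topology InnerProductSpace
open Filter MeasureTheory
open Literature.Analysis.FunctionSpaces Literature.Analysis.FunctionSpaces.Torus
namespace Summit.AnomalousDissipation.AnomalousDissipation.Theorems.TaylorGreenLoudGalerkinStates.GaugeHonesty
open Summit.AnomalousDissipation.AnomalousDissipation.Theorems.TaylorGreenLoudGalerkinStates
open Summit.AnomalousDissipation.AnomalousDissipation.Theorems.TaylorGreenLoudGalerkinStates.Negative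

/-! ## Per-state facts -/

/-- **Crude injection ceiling**: `∫⟪f_TG, U⟫ ≤ √(∫‖U‖²)` for smooth `U` (pointwise `‖f_TG‖ ≤ 1`, then
Jensen on the probability torus). [folklore] -/
theorem injection_le_sqrt_energy {U : UnitAddTorus (Fin 3) → EuclideanSpace ℝ (Fin 3)} (hs : IsSmooth U) :
    ∫ x, ⟪tgForce x, U x⟫_ℝ ≤ Real.sqrt (∫ x, ‖U x‖ ^ 2) := by
  -- adapted from `Negative.loudness_le_sqrt_energy` (Theorems/TaylorGreenLoudGalerkinStates/Negative/LoadBearing.lean)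
  calc ∫ x, ⟪tgForce x, U x⟫_ℝ ≤ ∫ x, ‖U x‖ := by
        refine integral_mono (continuous_tgForce.inner hs.continuous).integrable_unitAddTorus
          hs.continuous.norm.integrable_unitAddTorus fun x => ?_
        calc ⟪tgForce x, U x⟫_ℝ ≤ ‖tgForce x‖ * ‖U x‖ := real_inner_le_norm _ _
          _ ≤ 1 * ‖U x‖ := mul_le_mul_of_nonneg_right (norm_tgForce_le x) (norm_nonneg _)
          _ = ‖U x‖ := one_mul _
    _ ≤ Real.sqrt (∫ x, ‖U x‖ ^ 2) := integral_norm_le_sqrt hs.continuous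

/-- **Energy and enstrophy of the gauge field.**  For a `K`-tested steady state `U` of NS(`ν`, `f_TG`),
`ν > 0`, with injection `W := ∫⟪f_TG, U⟫` and gauge field `v := (1/(2W))•U − 2•f_TG`:
`1 + ∫‖v‖² = (1/(2W))²∫‖U‖²` and `12π² + ‖∇v‖² = (1/(2W))²‖∇U‖²` — because `2•f_TG + v = (1/(2W))•U`
(`GaugeBackward.two_smul_tgForce_add_gauge`), `v` is a `K`-field orthogonal to `f_TG`
(`GaugeBackward.stub_gaugeBackward`), `GaugeNorms.stub_gaugeNorms`, and the covariance of energy and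
enstrophy under `U ↦ c•U` (`Scaling`). [folklore] -/
theorem gauge_norms {ν : ℝ} {U : UnitAddTorus (Fin 3) → EuclideanSpace ℝ (Fin 3)} (hν : 0 < ν)
    (hU : IsKField U) (htest : ∀ a, IsKField a → testedForm ν tgForce U a = 0) :
    1 + ∫ x, ‖((1 / (2 * ∫ x, ⟪tgForce x, U x⟫_ℝ)) • U - (2 : ℝ) • tgForce) x‖ ^ 2 =
        (1 / (2 * ∫ x, ⟪tgForce x, U x⟫_ℝ)) ^ 2 * ∫ x, ‖U x‖ ^ 2 ∧
      12 * Real.pi ^ 2 + gradNormSq ((1 / (2 * ∫ x, ⟪tgForce x, U x⟫_ℝ)) • U - (2 : ℝ) • tgForce) =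
        (1 / (2 * ∫ x, ⟪tgForce x, U x⟫_ℝ)) ^ 2 * gradNormSq U := by
  obtain ⟨-, hvK, hvperp, -⟩ := GaugeBackward.stub_gaugeBackward ν U hν hU htest
  obtain ⟨-, hE, hG⟩ := GaugeNorms.stub_gaugeNorms _ hvK hvperp
  rw [GaugeBackward.two_smul_tgForce_add_gauge] at hE hG
  exact ⟨hE.symm.trans (Scaling.integral_norm_sq_const_smul _ _),
    hG.symm.trans (Scaling.gradNormSq_const_smul _ hU.1)⟩

/-! ## Real arithmetic -/

/-- **Energy bookkeeping.**  `1 + I_v = I/(4W²)`, `0 ≤ I_v`, `I ≤ E₁` and `0 < ε₁ ≤ W` give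
`I_v ≤ E₁/(4ε₁²)`. [folklore] -/
theorem energy_arith {W I Iv E₁ ε₁ : ℝ} (hε : 0 < ε₁) (hεW : ε₁ ≤ W) (hI : I ≤ E₁) (hIv : 0 ≤ Iv)
    (h : 1 + Iv = (1 / (2 * W)) ^ 2 * I) : Iv ≤ E₁ / (4 * ε₁ ^ 2) := by
  have hW : 0 < W := lt_of_lt_of_le hε hεW
  have hW0 : W ≠ 0 := hW.ne'
  have h' : I = (1 + Iv) * (4 * W ^ 2) := by
    rw [h]
    field_simp
    ring
  have hε2 : ε₁ ^ 2 ≤ W ^ 2 := pow_le_pow_left₀ hε.le hεW 2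
  rw [le_div_iff₀ (by positivity)]
  nlinarith [mul_le_mul_of_nonneg_left hε2 hIv, sq_nonneg W]

/-- **Loudness bookkeeping.**  With `νg = W`, `12π² + g_v = g/(4W²)`, `0 < ε₁ ≤ W`, `W² ≤ E₁` and
`ν ≤ ε₁/(96π²E₁)`: `(ν/(2W))·g_v = 1/(8W²) − 6π²ν/W ≥ 1/(8E₁) − 1/(16E₁) = 1/(16E₁)`. [folklore] -/
theorem loud_arith {ν W g gv E₁ ε₁ : ℝ} (hν : 0 < ν) (hε : 0 < ε₁) (hεW : ε₁ ≤ W) (hWE : W ^ 2 ≤ E₁)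
    (hng : ν * g = W) (hgv : 12 * Real.pi ^ 2 + gv = (1 / (2 * W)) ^ 2 * g)
    (hsmall : ν ≤ ε₁ / (96 * Real.pi ^ 2 * E₁)) :
    1 / (16 * E₁) ≤ ν / (2 * W) * gv := by
  have hW : 0 < W := lt_of_lt_of_le hε hεW
  have hE : 0 < E₁ := lt_of_lt_of_le (by positivity) hWE
  have hW0 : W ≠ 0 := hW.ne'
  have hν0 : ν ≠ 0 := hν.ne'
  have hE0 : E₁ ≠ 0 := hE.ne'
  have hε0 : ε₁ ≠ 0 := hε.ne'
  have hπ0 : Real.pi ≠ 0 := Real.pi_pos.ne'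
  have hg : g = W / ν := by
    rw [eq_div_iff hν0, mul_comm]
    exact hng
  have hgv' : gv = (1 / (2 * W)) ^ 2 * g - 12 * Real.pi ^ 2 := by linarith
  have hclosed : ν / (2 * W) * gv = 1 / (8 * W ^ 2) - 6 * Real.pi ^ 2 * ν / W := by
    rw [hgv', hg]
    field_simp
    ring
  rw [hclosed]
  have hA : 6 * Real.pi ^ 2 * ν / W ≤ 1 / (16 * E₁) := by
    calc 6 * Real.pi ^ 2 * ν / W ≤ 6 * Real.pi ^ 2 * ν / ε₁ :=
          div_le_div_of_nonneg_left (by positivity) hε hεW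
      _ ≤ 6 * Real.pi ^ 2 * (ε₁ / (96 * Real.pi ^ 2 * E₁)) / ε₁ :=
          div_le_div_of_nonneg_right (mul_le_mul_of_nonneg_left hsmall (by positivity)) hε.le
      _ = 1 / (16 * E₁) := by
          field_simp
          ring
  have hB : 2 * (1 / (16 * E₁)) ≤ 1 / (8 * W ^ 2) := by
    rw [show 2 * (1 / (16 * E₁)) = 1 / (8 * E₁) by field_simp; ring]
    exact div_le_div_of_nonneg_left zero_le_one (by positivity) (by linarith)
  linarith

/-- **The gauge viscosities tend to zero**: `ν_j/(2W_j) → 0` if `ν_j → 0⁺` and `W_j ≥ ε₁ > 0`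
(squeeze between `0` and `ν_j/(2ε₁)`). [folklore] -/
theorem tendsto_gauge_viscosity {ν W : ℕ → ℝ} {ε₁ : ℝ} (hν : ∀ j, 0 < ν j)
    (hlim : Filter.Tendsto ν Filter.atTop (nhds 0)) (hε : 0 < ε₁) (hεW : ∀ j, ε₁ ≤ W j) :
    Filter.Tendsto (fun j => ν j / (2 * W j)) Filter.atTop (nhds 0) := by
  -- adapted from `Gauge.stub_froth_of_gauge` (Theorems/MirrorVarietyTaylorGreenLoudGalerkinStatesGauge.lean)
  have hup : Filter.Tendsto (fun j => ν j / (2 * ε₁)) Filter.atTop (nhds 0) := by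
    simpa using hlim.div_const (2 * ε₁)
  refine tendsto_of_tendsto_of_tendsto_of_le_of_le tendsto_const_nhds hup (fun j => ?_) (fun j => ?_)
  · exact (div_pos (hν j) (by linarith [hεW j])).le
  · exact div_le_div_of_nonneg_left (hν j).le (by positivity) (by linarith [hεW j])

/-! ## The registered sub-goal -/

/-- **Sub-goal `gaugeHeart_of_exactStates`** (honesty direction of the gauge reshape of the line
`stagnation-plug-froth`).  Exact `K`-nondegenerate loud bounded `K`-symmetric steady Taylor–Green states
along `ν_j → 0⁺` imply the heart `stub_gaugeHeart`: with `W_j := ∫⟪f_TG, U_j⟫ ∈ [ε₁, √E₁]` the gauge fields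
`v_j := (1/(2W_j))•U_j − 2•f_TG` (`GaugeBackward.stub_gaugeBackward`) at gauge viscosities `ν_j/(2W_j) → 0`,
reindexed past the rank `J₀` from which `ν_j ≤ ε₁/(96π²E₁)`, are witnesses with `C = E₁/(4ε₁²)`,
`c = 1/(16E₁)` and inf-sup constants `M_j·2W_j`. [folklore] -/
theorem gaugeHeart_of_exactStates : (∃ (ν : ℕ → ℝ) (U : ℕ → UnitAddTorus (Fin 3) → EuclideanSpace ℝ (Fin 3)) (E₁ ε₁ : ℝ) (M : ℕ → ℝ), (∀ j, 0 < ν j) ∧ Filter.Tendsto ν Filter.atTop (nhds 0) ∧ 0 < ε₁ ∧ ∀ j, IsKField (U j) ∧ ∫ x, ‖U j x‖ ^ 2 ≤ E₁ ∧ ε₁ ≤ ν j * gradNormSq (U j) ∧ (∀ a, IsKField a → testedForm (ν j) tgForce (U j) a = 0) ∧ (∀ w, IsKField w → ∃ a, IsKField a ∧ Real.sqrt (gradNormSq w) * Real.sqrt (gradNormSq a) ≤ M j * linForm (ν j) (U j) w a ∧ (0 < gradNormSq w → 0 < gradNormSq a))) → ∃ (ν : ℕ → ℝ) (v : ℕ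 → UnitAddTorus (Fin 3) → EuclideanSpace ℝ (Fin 3)) (C c : ℝ) (M : ℕ → ℝ), (∀ j, 0 < ν j) ∧ Filter.Tendsto ν Filter.atTop (nhds 0) ∧ 0 < c ∧ ∀ j, IsKField (v j) ∧ (∫ x, inner ℝ (tgForce x) (v j x)) = 0 ∧ (∀ b, IsKField b → (∫ x, inner ℝ (tgForce x) (b x)) = 0 → testedForm (ν j) tgForce ((2 : ℝ) • tgForce + v j) b = 0) ∧ ∫ x, ‖v j x‖ ^ 2 ≤ C ∧ c ≤ ν j * gradNormSq (v j) ∧ (∀ w, IsKField w → ∃ a, IsKField a ∧ Real.sqrt (gradNormSq w) * Real.sqrt (gradNormSq a) ≤ M j * linForm (ν j) ((2 : ℝ) • tgForce + v j) w a ∧ (0 < gradNormSq w → 0 < gradNormSq a)) := by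
  rintro ⟨ν, U, E₁, ε₁, M, hνpos, hνlim, hε, hj⟩
  -- ### the per-`j` data
  have hUK : ∀ j, IsKField (U j) := fun j => (hj j).1
  have hUE : ∀ j, ∫ x, ‖U j x‖ ^ 2 ≤ E₁ := fun j => (hj j).2.1
  have hloud : ∀ j, ε₁ ≤ ν j * gradNormSq (U j) := fun j => (hj j).2.2.1
  have htest : ∀ j, ∀ a, IsKField a → testedForm (ν j) tgForce (U j) a = 0 := fun j => (hj j).2.2.2.1
  have hinf : ∀ j, ∀ w, IsKField w → ∃ a, IsKField a ∧
      Real.sqrt (gradNormSq w) * Real.sqrt (gradNormSq a) ≤ M j * linForm (ν j) (U j) w a ∧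
      (0 < gradNormSq w → 0 < gradNormSq a) := fun j => (hj j).2.2.2.2
  -- ### the injection `W_j = ∫⟪f_TG, U_j⟫ = ν_j‖∇U_j‖² ∈ [ε₁, √E₁]`
  set W : ℕ → ℝ := fun j => ∫ x, ⟪tgForce x, U j x⟫_ℝ with hW_def
  have hWeq : ∀ j, ν j * gradNormSq (U j) = W j := fun j =>
    GaugeBackward.energy_identity (hUK j) (htest j)
  have hεW : ∀ j, ε₁ ≤ W j := fun j => (hloud j).trans_eq (hWeq j)
  have hWpos : ∀ j, 0 < W j := fun j => lt_of_lt_of_le hε (hεW j)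
  have hWsqrt : ∀ j, W j ≤ Real.sqrt E₁ := fun j =>
    (injection_le_sqrt_energy (hUK j).1).trans (Real.sqrt_le_sqrt (hUE j))
  have hE₁ : 0 < E₁ := Real.sqrt_pos.1 (lt_of_lt_of_le (hWpos 0) (hWsqrt 0))
  have hWE : ∀ j, W j ^ 2 ≤ E₁ := fun j => (Real.le_sqrt (hWpos j).le hE₁.le).1 (hWsqrt j)
  -- ### the rank `J₀` past which `ν_j ≤ ε₁/(96π²E₁)`, and the gauge viscosities `ν_j/(2W_j) → 0`
  have hδ : 0 < ε₁ / (96 * Real.pi ^ 2 * E₁) := by positivity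
  obtain ⟨J₀, hJ₀⟩ := Filter.eventually_atTop.1 (hνlim.eventually_le_const hδ)
  have hμlim : Filter.Tendsto (fun j => ν (j + J₀) / (2 * W (j + J₀))) Filter.atTop (nhds 0) :=
    (tendsto_add_atTop_iff_nat (f := fun j => ν j / (2 * W j)) J₀).2
      (tendsto_gauge_viscosity hνpos hνlim hε hεW)
  -- ### the witnesses (reindexed by `J₀`)
  refine ⟨fun j => ν (j + J₀) / (2 * W (j + J₀)),
    fun j => (1 / (2 * W (j + J₀))) • U (j + J₀) - (2 : ℝ) • tgForce,
    E₁ / (4 * ε₁ ^ 2), 1 / (16 * E₁), fun j => M (j + J₀) * (2 * W (j + J₀)),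
    fun j => div_pos (hνpos _) (by have := hWpos (j + J₀); positivity), hμlim, by positivity,
    fun j => ?_⟩
  obtain ⟨-, hvK, hvperp, hcell⟩ :=
    GaugeBackward.stub_gaugeBackward (ν (j + J₀)) (U (j + J₀)) (hνpos _) (hUK _) (htest _)
  obtain ⟨hEn, hGr⟩ := gauge_norms (hνpos (j + J₀)) (hUK (j + J₀)) (htest (j + J₀))
  refine ⟨hvK, hvperp, hcell, ?_, ?_, ?_⟩
  · -- energy: `∫‖v‖² ≤ E₁/(4ε₁²)`
    exact energy_arith hε (hεW (j + J₀)) (hUE (j + J₀)) (integral_nonneg fun x => by positivity) hEn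
  · -- non-degeneration: `1/(16E₁) ≤ (ν/(2W))‖∇v‖²` for `j + J₀ ≥ J₀`
    exact loud_arith (hνpos (j + J₀)) hε (hεW (j + J₀)) (hWE (j + J₀)) (hWeq (j + J₀)) hGr
      (hJ₀ _ (Nat.le_add_left J₀ j))
  · -- `K`-inf-sup with constant `M·2W` (covariance of `linForm`)
    intro w hw
    obtain ⟨a, ha, hle, hnd⟩ := hinf (j + J₀) w hw
    refine ⟨a, ha, ?_, hnd⟩
    have hW0 : W (j + J₀) ≠ 0 := (hWpos (j + J₀)).ne'
    have key : linForm (ν (j + J₀) / (2 * W (j + J₀)))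
        ((2 : ℝ) • tgForce + ((1 / (2 * W (j + J₀))) • U (j + J₀) - (2 : ℝ) • tgForce)) w a =
        1 / (2 * W (j + J₀)) * linForm (ν (j + J₀)) (U (j + J₀)) w a := by
      rw [GaugeBackward.two_smul_tgForce_add_gauge, Scaling.linForm_scaling]
    have hcancel : M (j + J₀) * (2 * W (j + J₀)) * (1 / (2 * W (j + J₀)) * linForm (ν (j + J₀)) (U (j + J₀)) w a) =
        M (j + J₀) * linForm (ν (j + J₀)) (U (j + J₀)) w a := by
      field_simp
    have hfin : Real.sqrt (gradNormSq w) * Real.sqrt (gradNormSq a) ≤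
        M (j + J₀) * (2 * W (j + J₀)) * linForm (ν (j + J₀) / (2 * W (j + J₀)))
          ((2 : ℝ) • tgForce + ((1 / (2 * W (j + J₀))) • U (j + J₀) - (2 : ℝ) • tgForce)) w a := by
      rw [key, hcancel]
      exact hle
    exact hfin

end Summit.AnomalousDissipation.AnomalousDissipation.Theorems.TaylorGreenLoudGalerkinStates.GaugeHonesty

end
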